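import Literature.AlgebraicGeometry.Resolution.Kuhlmann2019HenselianRationalityStepsProofs
import Literature.AlgebraicGeometry.Resolution.HenselizationDegree
import Literature.AlgebraicGeometry.Resolution.DefectAmbient
import Literature.AlgebraicGeometry.Resolution.DefectTransport
import Literature.AlgebraicGeometry.Resolution.GeneralizedStabilityProofs
import Mathlib.FieldTheory.PurelyInseparable.Tower
import Mathlib.FieldTheory.PrimitiveElement
import HarnessLib

/-!
# Separable defectlessness descends along dense purely inseparable extensions

Topic: `Literature/AlgebraicGeometry/Resolution` (valued function fields). PROVED valuation
theory for the discharge of the named fact `Kuhlmann2010SeparablyDefectlessRational_sepClosed`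
(`Kuhlmann2019HenselianRationalitySteps.lean`) = F.-V. Kuhlmann, *Elimination of ramification I:
The generalized stability theorem*, Trans. AMS 362 (2010) = arXiv:1003.5678, **Thm. 1.1, the
"separably defectless" clause** ("If `vK` is cofinal in `vF`, then it also holds for 'separably
defectless' in the place of 'defectless'") for `K(x)`, `x` value-transcendental over a separably
closed `K`. The printed proof of that clause (§5, p. 20 of the arXiv version) is

> Assume that `(K,v)` is a separably defectless field, `(F|K,v)` is a valued function field
> without transcendence defect, and that `vK` is cofinal in `vF`. Then the completion `F^c` of
> `(F,v)` contains the completion `K^c` of `(K,v)`. A valued field is separably defectless if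
> and only if its completion is defectless (cf. [K6]). Hence, `K^c` is a defectless field. We
> consider the subfield `F.K^c ⊂ F^c` which is a function field over `K^c`. … By the
> "defectless" version of Theorem 1.1 it follows that `(K^c.F,v)` is a defectless field. Hence
> also its completion `(F^c,v)` is defectless. By the above cited theorem it follows that
> `(F,v)` is [separably] defectless.

([K6] = F.-V. Kuhlmann, *A classification of Artin–Schreier defect extensions and
characterizations of defectless fields*, Illinois J. Math. 54 (2010).) Over a separably closed
`K` the completion can be replaced by the perfect hull `K^{1/p^∞} ⊆ K^c` (an algebraically
closed field in which `K` is DENSE), and the only piece of [K6] that is needed is the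
finite-level mechanism by which defect data of SEPARABLE extensions do not change along a dense
extension. This file proves that mechanism in the form used there:

## Content

* `IsDenseIn V A B` — the subfield `A` is dense in the subfield `B` of `(Ω, V)`: every `y ∈ B` is
  approximable by elements of `A` to within every value of `B^×`. DEFINITION.
* `denseClosure V A B` — the elements of `B` approximable from `A`; a SUBFIELD of `Ω`
  (`mem_denseClosure_iff`, `le_denseClosure`, `isDenseIn_iff_le_denseClosure`,
  `isDenseIn_of_closure_eq`: density is checked on generators). DEFINITION + API, PROVED.
* `IsDenseIn.isImmediateOver` — dense extensions are immediate; `valueSubgroup_eq_of_dense`,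
  `residueSubfield_eq_of_dense` (typed forms); `ramificationIndex_comap_algHom`,
  `inertiaDegree_comap_algHom` (`e`, `f` of the valuation ring cut out by an embedding, in
  ambient terms). PROVED. (Values of algebraic elements are bounded below by values of the
  ground field: `exists_valuation_le_of_isAlgebraic`, `Kuhlmann2019HenselianRationalityStepsProofs.lean`.)
* `IsSeparablyDefectlessField.of_isDenseIn` — **the descent**: for subfields `F ≤ F'` of an
  algebraically closed `(Ω, V)` with `F'|F` purely inseparable and `F` dense in `F'`, if
  `(F', V ∩ F')` is separably defectless then so is `(F, V ∩ F)`. PROVED (primitive element,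
  `minpoly.map_eq_of_isSeparable_of_isPurelyInseparable`, the bijection "restriction to `L`"
  between the extensions of the valuation to `L' = F'(α)` and to `L = F(α)`, and equality of
  `e`, `f` by density of `L` in `L'`).

## Sources

* F.-V. Kuhlmann, Trans. AMS 362 (2010) = arXiv:1003.5678: §1 (p. 3: separably defectless
  fields), Thm. 1.1, §5 (p. 20). The statements of this file are [folklore].

## Rendering notes

* As in `ValuedFunctionFields.lean` / `Kuhlmann2019HenselianRationalitySteps.lean`: subfields of
  one valued field `(Ω, V)`, `O_E = V ∩ E = V.comap (algebraMap E Ω)`; `e`, `f`,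
  `IsDefectlessIn`, `IsSeparablyDefectlessField` are those of `ValuationDefect.lean` /
  `Kuhlmann2019HenselianRationalitySteps.lean`; all extensions of `V ∩ F` to a finite `L|F` are
  cut out by `F`-embeddings `L → Ω` (`exists_algHom_comap_eq`, `HenselizationDegree.lean`).
* "Purely inseparable" is stated elementwise (`y ^ (ringExpChar Ω) ^ n ∈ F`), which in
  characteristic `0` means `F' = F`.
-/

noncomputable section

open IsLocalRing

namespace Literature.AlgebraicGeometry.Resolution

universe u

/-! ### Dense subfields -/

section Dense

variable {Ω : Type u} [Field Ω] (V : ValuationSubring Ω)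

/-- **`A` is dense in `B`** (for subfields `A`, `B` of the valued field `(Ω, V)`): every element
of `B` can be approximated by elements of `A` to within any value of a non-zero element of `B`
(additively: for `y ∈ B` and `γ ∈ vB` there is `z ∈ A` with `v(y - z) > γ`). [folklore] -/
def IsDenseIn (A B : Subfield Ω) : Prop :=
  ∀ y ∈ B, ∀ c ∈ B, c ≠ 0 → ∃ z ∈ A, V.valuation (y - z) < V.valuation c

/-- The **closure of `A` in `B`**: the elements of `B` approximable from `A` to within every
value of `B^×`. It is a subfield of `Ω`. [folklore] -/
def denseClosure (A B : Subfield Ω) : Subfield Ω where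
  carrier := {y | y ∈ B ∧ ∀ c ∈ B, c ≠ 0 → ∃ z ∈ A, V.valuation (y - z) < V.valuation c}
  mul_mem' := by
    rintro y₁ y₂ ⟨hy₁, h₁⟩ ⟨hy₂, h₂⟩
    refine ⟨B.mul_mem hy₁ hy₂, fun c hc hc0 => ?_⟩
    have hvc : 0 < V.valuation c := (Valuation.pos_iff _).mpr hc0
    by_cases hy₁0 : y₁ = 0
    · exact ⟨0, A.zero_mem, by rw [hy₁0, zero_mul, sub_zero, map_zero]; exact hvc⟩
    by_cases hy₂0 : y₂ = 0
    · exact ⟨0, A.zero_mem, by rw [hy₂0, mul_zero, sub_zero, map_zero]; exact hvc⟩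
    have hv₁ : 0 < V.valuation y₁ := (Valuation.pos_iff _).mpr hy₁0
    have hv₂ : 0 < V.valuation y₂ := (Valuation.pos_iff _).mpr hy₂0
    -- `z₂` close to `y₂`: closer than `v(c/y₁)` and than `v(y₂)`
    obtain ⟨z₂, hz₂A, hz₂⟩ : ∃ z₂ ∈ A, V.valuation (y₂ - z₂) < V.valuation (c / y₁) ∧
        V.valuation (y₂ - z₂) < V.valuation y₂ := by
      rcases le_total (V.valuation (c / y₁)) (V.valuation y₂) with hle | hle
      · obtain ⟨z, hzA, hz⟩ := h₂ (c / y₁) (B.div_mem hc hy₁) (div_ne_zero hc0 hy₁0)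
        exact ⟨z, hzA, hz, lt_of_lt_of_le hz hle⟩
      · obtain ⟨z, hzA, hz⟩ := h₂ y₂ hy₂ hy₂0
        exact ⟨z, hzA, lt_of_lt_of_le hz hle, hz⟩
    have hvz₂ : V.valuation z₂ = V.valuation y₂ := by
      have : z₂ = y₂ + -(y₂ - z₂) := by ring
      rw [this, Valuation.map_add_eq_of_lt_left]
      rw [Valuation.map_neg]
      exact hz₂.2
    obtain ⟨z₁, hz₁A, hz₁⟩ := h₁ (c / y₂) (B.div_mem hc hy₂) (div_ne_zero hc0 hy₂0)
    refine ⟨z₁ * z₂, A.mul_mem hz₁A hz₂A, ?_⟩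
    have hsplit : y₁ * y₂ - z₁ * z₂ = y₁ * (y₂ - z₂) + z₂ * (y₁ - z₁) := by ring
    rw [hsplit]
    refine lt_of_le_of_lt (V.valuation.map_add _ _) (max_lt ?_ ?_)
    · rw [Valuation.map_mul]
      rw [map_div₀, lt_div_iff₀ hv₁] at hz₂
      rw [mul_comm]
      exact hz₂.1
    · rw [Valuation.map_mul, hvz₂]
      rw [map_div₀, lt_div_iff₀ hv₂] at hz₁
      rw [mul_comm]
      exact hz₁
  one_mem' := ⟨B.one_mem, fun c _ hc0 =>
    ⟨1, A.one_mem, by rw [sub_self, map_zero]; exact (Valuation.pos_iff _).mpr hc0⟩⟩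
  add_mem' := by
    rintro y₁ y₂ ⟨hy₁, h₁⟩ ⟨hy₂, h₂⟩
    refine ⟨B.add_mem hy₁ hy₂, fun c hc hc0 => ?_⟩
    obtain ⟨z₁, hz₁A, hz₁⟩ := h₁ c hc hc0
    obtain ⟨z₂, hz₂A, hz₂⟩ := h₂ c hc hc0
    refine ⟨z₁ + z₂, A.add_mem hz₁A hz₂A, ?_⟩
    have hsplit : y₁ + y₂ - (z₁ + z₂) = (y₁ - z₁) + (y₂ - z₂) := by ring
    rw [hsplit]
    exact lt_of_le_of_lt (V.valuation.map_add _ _) (max_lt hz₁ hz₂)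
  zero_mem' := ⟨B.zero_mem, fun c _ hc0 =>
    ⟨0, A.zero_mem, by rw [sub_self, map_zero]; exact (Valuation.pos_iff _).mpr hc0⟩⟩
  neg_mem' := by
    rintro y ⟨hy, h⟩
    refine ⟨B.neg_mem hy, fun c hc hc0 => ?_⟩
    obtain ⟨z, hzA, hz⟩ := h c hc hc0
    refine ⟨-z, A.neg_mem hzA, ?_⟩
    have hsplit : -y - -z = -(y - z) := by ring
    rwa [hsplit, Valuation.map_neg]
  inv_mem' := by
    rintro y ⟨hy, h⟩
    refine ⟨B.inv_mem hy, fun c hc hc0 => ?_⟩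
    have hvc : 0 < V.valuation c := (Valuation.pos_iff _).mpr hc0
    by_cases hy0 : y = 0
    · exact ⟨0, A.zero_mem, by rw [hy0, inv_zero, sub_zero, map_zero]; exact hvc⟩
    have hv : 0 < V.valuation y := (Valuation.pos_iff _).mpr hy0
    -- `z` close to `y`: closer than `v(y)` and than `v(c y²)`
    obtain ⟨z, hzA, hz⟩ : ∃ z ∈ A, V.valuation (y - z) < V.valuation y ∧
        V.valuation (y - z) < V.valuation (c * y ^ 2) := by
      rcases le_total (V.valuation y) (V.valuation (c * y ^ 2)) with hle | hle
      · obtain ⟨z, hzA, hz⟩ := h y hy hy0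
        exact ⟨z, hzA, hz, lt_of_lt_of_le hz hle⟩
      · obtain ⟨z, hzA, hz⟩ := h (c * y ^ 2) (B.mul_mem hc (B.pow_mem hy 2))
          (mul_ne_zero hc0 (pow_ne_zero 2 hy0))
        exact ⟨z, hzA, lt_of_lt_of_le hz hle, hz⟩
    have hvz : V.valuation z = V.valuation y := by
      have : z = y + -(y - z) := by ring
      rw [this, Valuation.map_add_eq_of_lt_left]
      rw [Valuation.map_neg]
      exact hz.1
    have hz0 : z ≠ 0 := fun h0 => by
      rw [h0, map_zero] at hvz
      exact hv.ne' hvz.symm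
    refine ⟨z⁻¹, A.inv_mem hzA, ?_⟩
    have hsplit : y⁻¹ - z⁻¹ = -(y - z) / (y * z) := by
      field_simp
      ring
    rw [hsplit, map_div₀, Valuation.map_neg, Valuation.map_mul, hvz, div_lt_iff₀ (mul_pos hv hv)]
    rw [Valuation.map_mul, Valuation.map_pow] at hz
    calc V.valuation (y - z) < V.valuation c * V.valuation y ^ 2 := hz.2
      _ = V.valuation c * (V.valuation y * V.valuation y) := by rw [pow_two]

variable {V}

/-- Membership in the closure of `A` in `B`. [folklore] -/
theorem mem_denseClosure_iff {A B : Subfield Ω} {y : Ω} :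
    y ∈ denseClosure V A B ↔
      y ∈ B ∧ ∀ c ∈ B, c ≠ 0 → ∃ z ∈ A, V.valuation (y - z) < V.valuation c :=
  Iff.rfl

/-- The closure of `A` in `B` lies in `B`. [folklore] -/
theorem denseClosure_le (A B : Subfield Ω) : denseClosure V A B ≤ B := fun _ hy => hy.1

/-- `A ∩ B` lies in the closure of `A` in `B`. [folklore] -/
theorem le_denseClosure {A B : Subfield Ω} (hAB : A ≤ B) : A ≤ denseClosure V A B :=
  fun y hy => ⟨hAB hy, fun c _ hc0 =>
    ⟨y, hy, by rw [sub_self, map_zero]; exact (Valuation.pos_iff _).mpr hc0⟩⟩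

/-- `A` is dense in `B` iff `B` is contained in the closure of `A` in `B`. [folklore] -/
theorem isDenseIn_iff_le_denseClosure {A B : Subfield Ω} :
    IsDenseIn V A B ↔ B ≤ denseClosure V A B :=
  ⟨fun h _ hy => ⟨hy, fun c hc hc0 => h _ hy c hc hc0⟩, fun h _ hy c hc hc0 => (h hy).2 c hc hc0⟩

/-- **Density is checked on generators**: if `B` is generated by a set `S` of elements lying in
the closure of `A` in `B`, then `A` is dense in `B`. [folklore] -/
theorem isDenseIn_of_closure_eq {A B : Subfield Ω} {S : Set Ω} (hS : Subfield.closure S = B)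
    (h : ∀ y ∈ S, y ∈ denseClosure V A B) : IsDenseIn V A B := by
  rw [isDenseIn_iff_le_denseClosure]
  exact hS.symm.le.trans (Subfield.closure_le.mpr h)

/-- A dense subfield has the same values: for `y ∈ B`, `y ≠ 0`, some `z ∈ A` has
`v(y - z) < v(y)`, hence `v(z) = v(y)`. [folklore] -/
theorem IsDenseIn.exists_valuation_eq {A B : Subfield Ω} (h : IsDenseIn V A B) {y : Ω} (hy : y ∈ B)
    (hy0 : y ≠ 0) : ∃ z ∈ A, V.valuation (y - z) < V.valuation y ∧ V.valuation z = V.valuation y := by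
  obtain ⟨z, hzA, hz⟩ := h y hy y hy hy0
  refine ⟨z, hzA, hz, ?_⟩
  have : z = y + -(y - z) := by ring
  rw [this, Valuation.map_add_eq_of_lt_left]
  rwa [Valuation.map_neg]

/-- A dense extension is immediate (`vB ⊆ vA`, `Bv ⊆ Av`). [folklore] -/
theorem IsDenseIn.isImmediateOver {A B : Subfield Ω} (h : IsDenseIn V A B) :
    IsImmediateOver V A B := by
  refine ⟨fun y hy hy0 => ?_, fun r hr => ?_⟩
  · obtain ⟨z, hzA, -, hz⟩ := h.exists_valuation_eq hy hy0
    exact ⟨z, hzA, hz.symm⟩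
  · obtain ⟨a, haB, rfl⟩ := (mem_resField_iff V B r).mp hr
    obtain ⟨z, hzA, hz⟩ := h (a : Ω) haB 1 B.one_mem one_ne_zero
    rw [map_one] at hz
    have hzV : z ∈ V := by
      have : z = (a : Ω) - ((a : Ω) - z) := by ring
      rw [this]
      exact V.sub_mem a.2 ((V.valuation_le_one_iff _).mp hz.le)
    refine (mem_resField_iff V A _).mpr ⟨⟨z, hzV⟩, hzA, ?_⟩
    have hsub : residue V (a - ⟨z, hzV⟩) = 0 := by
      rw [residue_eq_zero_iff, ValuationSubring.valuation_lt_one_iff]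
      exact hz
    rw [map_sub, sub_eq_zero] at hsub
    exact hsub.symm

end Dense

/-! ### Dense subfields have the same value group and residue field; `e`, `f` along embeddings -/

section Typed

variable {Ω : Type u} [Field Ω] (V : ValuationSubring Ω)
variable {A₁ A₂ : Type u} [Field A₁] [Field A₂] [Algebra A₁ Ω] [Algebra A₂ Ω]

/-- If `A₁ ⊆ A₂` inside `Ω` and every non-zero `y ∈ A₂` has some `z ∈ A₁` with
`v(y - z) < v(y)`, then `vA₁ = vA₂`. [folklore] -/
theorem valueSubgroup_eq_of_dense
    (h₁₂ : Set.range (algebraMap A₁ Ω) ⊆ Set.range (algebraMap A₂ Ω))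
    (hd : ∀ y ∈ Set.range (algebraMap A₂ Ω), y ≠ 0 →
      ∃ z ∈ Set.range (algebraMap A₁ Ω), V.valuation (y - z) < V.valuation y) :
    valueSubgroup A₁ V = valueSubgroup A₂ V := by
  refine le_antisymm (valueSubgroup_le_of_range_subset V h₁₂) fun γ hγ => ?_
  obtain ⟨c, hc0, hγ⟩ := (mem_valueSubgroup_iff A₂ V γ).mp hγ
  have hc0' : algebraMap A₂ Ω c ≠ 0 := (map_ne_zero _).mpr hc0
  obtain ⟨_, ⟨d, rfl⟩, hz⟩ := hd _ ⟨c, rfl⟩ hc0'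
  have hvd : V.valuation (algebraMap A₁ Ω d) = V.valuation (algebraMap A₂ Ω c) := by
    have : algebraMap A₁ Ω d = algebraMap A₂ Ω c + -(algebraMap A₂ Ω c - algebraMap A₁ Ω d) := by
      ring
    rw [this, Valuation.map_add_eq_of_lt_left]
    rwa [Valuation.map_neg]
  refine (mem_valueSubgroup_iff A₁ V γ).mpr ⟨d, ?_, by rw [hvd]; exact hγ⟩
  rintro rfl
  rw [map_zero, map_zero] at hvd
  exact hc0' ((map_eq_zero _).mp hvd.symm)

/-- If `A₁ ⊆ A₂` inside `Ω` and every `y ∈ A₂ ∩ V` has some `z ∈ A₁` with `v(y - z) < 1`,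
then `A₁v = A₂v`. [folklore] -/
theorem residueSubfield_eq_of_dense
    (h₁₂ : Set.range (algebraMap A₁ Ω) ⊆ Set.range (algebraMap A₂ Ω))
    (hd : ∀ y ∈ Set.range (algebraMap A₂ Ω), y ∈ V →
      ∃ z ∈ Set.range (algebraMap A₁ Ω), V.valuation (y - z) < 1) :
    residueSubfield A₁ V = residueSubfield A₂ V := by
  refine le_antisymm (residueSubfield_le_of_range_subset V h₁₂) fun r hr => ?_
  obtain ⟨c, hc, rfl⟩ := (mem_residueSubfield_iff A₂ V r).mp hr
  obtain ⟨_, ⟨d, rfl⟩, hz⟩ := hd _ ⟨c, rfl⟩ hc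
  have hdV : algebraMap A₁ Ω d ∈ V := by
    have : algebraMap A₁ Ω d = algebraMap A₂ Ω c - (algebraMap A₂ Ω c - algebraMap A₁ Ω d) := by
      ring
    rw [this]
    exact V.sub_mem hc ((V.valuation_le_one_iff _).mp hz.le)
  refine (mem_residueSubfield_iff A₁ V _).mpr ⟨d, hdV, ?_⟩
  have hsub : residue V (⟨algebraMap A₂ Ω c, hc⟩ - ⟨algebraMap A₁ Ω d, hdV⟩) = 0 := by
    rw [residue_eq_zero_iff, ValuationSubring.valuation_lt_one_iff]
    exact hz
  rw [map_sub, sub_eq_zero] at hsub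
  exact hsub.symm

variable {K : Type u} [Field K] [Algebra K Ω] {L : Type u} [Field L] [Algebra K L]

/-- **`e(ι⁻¹V | K) = (v ι(L) : vK)`** for a `K`-embedding `ι : L → Ω`: transport along
`L ≅ ι(L)` and the ambient description of `e` (`ramificationIndex_comap_eq_relIndex`).
[folklore] -/
theorem ramificationIndex_comap_algHom (ι : L →ₐ[K] Ω) :
    ramificationIndex K (V.comap ι.toRingHom) =
      (valueSubgroup K V).relIndex (valueSubgroup ι.fieldRange V) := by
  let e : L ≃ₐ[K] ι.fieldRange := AlgEquiv.ofInjectiveField ι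
  have hW : V.comap ι.toRingHom =
      (V.comap (algebraMap ι.fieldRange Ω)).comap e.toRingEquiv.toRingHom := by
    ext y
    rfl
  have hc : ∀ x : K, e.toRingEquiv (algebraMap K L x) = algebraMap K ι.fieldRange
      (RingEquiv.refl K x) := fun x => Subtype.ext (ι.commutes x)
  rw [ramificationIndex_congr (RingEquiv.refl K) e.toRingEquiv hc hW,
    ramificationIndex_comap_eq_relIndex]

/-- **`f(ι⁻¹V | K) = [ι(L)v : Kv]`** for a `K`-embedding `ι : L → Ω`. [folklore] -/
theorem inertiaDegree_comap_algHom (ι : L →ₐ[K] Ω) :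
    inertiaDegree K (V.comap ι.toRingHom) =
      (residueSubfield K V).relfinrank (residueSubfield ι.fieldRange V) := by
  let e : L ≃ₐ[K] ι.fieldRange := AlgEquiv.ofInjectiveField ι
  have hW : V.comap ι.toRingHom =
      (V.comap (algebraMap ι.fieldRange Ω)).comap e.toRingEquiv.toRingHom := by
    ext y
    rfl
  have hc : ∀ x : K, e.toRingEquiv (algebraMap K L x) = algebraMap K ι.fieldRange
      (RingEquiv.refl K x) := fun x => Subtype.ext (ι.commutes x)
  rw [inertiaDegree_congr (RingEquiv.refl K) e.toRingEquiv hc hW,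
    inertiaDegree_comap_eq_relfinrank]

/-- The range of a `K`-embedding, as a set. [folklore] -/
theorem range_algebraMap_fieldRange (ι : L →ₐ[K] Ω) :
    Set.range (algebraMap ι.fieldRange Ω) = Set.range ι := by
  ext y
  constructor
  · rintro ⟨⟨_, x, rfl⟩, rfl⟩
    exact ⟨x, rfl⟩
  · rintro ⟨x, rfl⟩
    exact ⟨⟨ι x, AlgHom.mem_fieldRange.mpr ⟨x, rfl⟩⟩, rfl⟩

end Typed


/-! ### The descent -/

section Descent

variable {Ω : Type u} [Field Ω] [IsAlgClosed Ω] (V : ValuationSubring Ω)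

/-- **Separable defectlessness descends along a dense purely inseparable extension.** Let
`F ≤ F'` be subfields of the algebraically closed valued field `(Ω, V)` such that every element
of `F'` has a `p`-power-th power in `F` (`p` the characteristic exponent) and `F` is dense in
`F'`. If `(F', V ∩ F')` is a separably defectless field, then so is `(F, V ∩ F)`.
*Proof.* For `L = F(α) | F` finite separable and an `F`-embedding `ι₀ : L → Ω`, the extension
`L' = F'(ι₀α)` has `[L' : F'] = [L : F]` (the minimal polynomial of a separable element does not
change under a purely inseparable base extension), `L' | ι₀(L)` is purely inseparable, and the
restriction `O'' ↦ O'' ∩ L` is a bijection from the extensions of `V ∩ F'` to `L'` onto the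
extensions of `V ∩ F` to `L` (injective by pure inseparability, surjective because every
extension is cut out by an embedding into `Ω`) preserving `e` and `f`: writing `O'' = κ⁻¹V`
for an `F'`-embedding `κ` of `L'`, `vF = vF'`, `Fv = F'v` and `v(κ(L)) = v(κ(L'))`,
`κ(L)v = κ(L')v` because `F` is dense in `F'` and hence `κ(L) = ⊕ F·κ(α)ⁱ` is dense in
`κ(L') = ⊕ F'·κ(α)ⁱ`. So `∑ e f` over the extensions to `L` equals `∑ e f` over the extensions
to `L'`, which is `[L' : F'] = [L : F]`. (This is the finite-level mechanism behind "a valued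
field is separably defectless if and only if its completion is defectless", F.-V. Kuhlmann,
Illinois J. Math. 54 (2010), quoted in Kuhlmann 2010, §5, p. 20.) [folklore] -/
theorem IsSeparablyDefectlessField.of_isDenseIn {F F' : Subfield Ω} (hFF' : F ≤ F')
    (hpi : ∀ y ∈ F', ∃ n : ℕ, y ^ (ringExpChar Ω) ^ n ∈ F) (hdense : IsDenseIn V F F')
    (hSD : IsSeparablyDefectlessField F' (V.comap (algebraMap F' Ω))) :
    IsSeparablyDefectlessField F (V.comap (algebraMap F Ω)) := by
  intro L _ _ hfin hsep
  haveI := hfin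
  haveI := hsep
  classical
  -- the typed tower `F → F' → Ω`, purely inseparable
  letI : Algebra F F' := (Subfield.inclusion hFF').toAlgebra
  haveI : IsScalarTower F F' Ω := IsScalarTower.of_algebraMap_eq fun _ => rfl
  haveI : IsPurelyInseparable F F' := by
    rw [isPurelyInseparable_iff_pow_mem F (ringExpChar F)]
    intro y
    obtain ⟨n, hn⟩ := hpi y y.2
    refine ⟨n, ⟨⟨_, hn⟩, Subtype.ext ?_⟩⟩
    change (y : Ω) ^ ringExpChar Ω ^ n = ((y ^ ringExpChar F ^ n : F') : Ω)
    rw [ringExpChar_subfield_eq F, SubmonoidClass.coe_pow]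
  -- a non-zero primitive element `α` of `L | F`
  obtain ⟨α, hα, hα0⟩ : ∃ α : L, IntermediateField.adjoin F ({α} : Set L) = ⊤ ∧ α ≠ 0 := by
    obtain ⟨α, hα⟩ := Field.exists_primitive_element F L
    by_cases hα0 : α = 0
    · refine ⟨1, ?_, one_ne_zero⟩
      rw [hα0, IntermediateField.adjoin_zero] at hα
      rw [IntermediateField.adjoin_one, hα]
    · exact ⟨α, hα, hα0⟩
  have hαint : IsIntegral F α := IsIntegral.of_finite F α
  have hαsep : IsSeparable F α := Algebra.IsSeparable.isSeparable F α
  haveI : Algebra.IsAlgebraic F L := Algebra.IsAlgebraic.of_finite F L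
  -- an `F`-embedding `ι₀ : L → Ω`; `L' = F'(ι₀ α)`
  let ι₀ : L →ₐ[F] Ω := IsAlgClosed.lift
  have hbint : IsIntegral F (ι₀ α) := hαint.map ι₀
  have hbsep : IsSeparable F (ι₀ α) := IsSeparable.map ι₀ ι₀.injective hαsep
  have hbint' : IsIntegral F' (ι₀ α) := hbint.tower_top
  have hbsep' : IsSeparable F' (ι₀ α) := IsSeparable.tower_top F' hbsep
  have hmin : minpoly F' (ι₀ α) = (minpoly F α).map (algebraMap F F') := by
    rw [← minpoly.map_eq_of_isSeparable_of_isPurelyInseparable F' (ι₀ α) hbsep,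
      minpoly.algHom_eq ι₀ ι₀.injective α]
  set L' : IntermediateField F' Ω := IntermediateField.adjoin F' ({ι₀ α} : Set Ω) with hL'def
  haveI hL'fin : FiniteDimensional F' L' := IntermediateField.adjoin.finiteDimensional hbint'
  haveI hL'sep : Algebra.IsSeparable F' L' :=
    (IntermediateField.isSeparable_adjoin_simple_iff_isSeparable F' Ω).mpr hbsep'
  -- degrees: `[L : F] = deg minpoly_F(α) = [L' : F']`
  have hdegL : Module.finrank F L = (minpoly F α).natDegree := by
    rw [← IntermediateField.finrank_top', ← hα, IntermediateField.adjoin.finrank hαint]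
  have hdegL' : Module.finrank F' L' = (minpoly F α).natDegree := by
    rw [hL'def, IntermediateField.adjoin.finrank hbint', hmin, Polynomial.natDegree_map]
  -- `ι₀(L) ⊆ L'`, the restriction map `j : L → L'`
  have hι₀mem : ∀ x : L, ι₀ x ∈ L' := by
    intro x
    have hx : ι₀ x ∈ IntermediateField.adjoin F ({ι₀ α} : Set Ω) := by
      rw [← Set.image_singleton, ← IntermediateField.adjoin_map, hα, ← AlgHom.fieldRange_eq_map]
      exact AlgHom.mem_fieldRange.mpr ⟨x, rfl⟩
    have hle : IntermediateField.adjoin F ({ι₀ α} : Set Ω) ≤ L'.restrictScalars F :=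
      IntermediateField.adjoin_le_iff.mpr (Set.singleton_subset_iff.mpr
        (IntermediateField.subset_adjoin F' ({ι₀ α} : Set Ω) (Set.mem_singleton _)))
    exact hle hx
  let j : L →+* L' := ι₀.toRingHom.codRestrict L' hι₀mem
  have hj : ∀ x : L, ((j x : L') : Ω) = ι₀ x := fun _ => rfl
  have hjF : ∀ c : F, j (algebraMap F L c) = algebraMap F' L' (algebraMap F F' c) :=
    fun c => Subtype.ext (ι₀.commutes c)
  have hjα : j α = IntermediateField.AdjoinSimple.gen F' (ι₀ α) := Subtype.ext rfl
  have hjα0 : j α ≠ 0 := (map_ne_zero j).mpr hα0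
  -- every element of `L'` has a `p`-power-th power in `j(L)`
  have hpow : ∀ y ∈ L', ∃ n : ℕ, ∃ x : L, y ^ (ringExpChar Ω) ^ n = ι₀ x := by
    intro y hy
    induction hy using IntermediateField.adjoin_induction with
    | mem x hx =>
      rw [Set.mem_singleton_iff] at hx
      exact ⟨0, α, by rw [hx, pow_zero, pow_one]⟩
    | algebraMap c =>
      obtain ⟨n, hn⟩ := hpi c c.2
      exact ⟨n, algebraMap F L ⟨_, hn⟩, by rw [ι₀.commutes]; rfl⟩
    | add x y _ _ ihx ihy =>
      obtain ⟨m, x', hx'⟩ := ihx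
      obtain ⟨n, y', hy'⟩ := ihy
      refine ⟨m + n, x' ^ (ringExpChar Ω) ^ n + y' ^ (ringExpChar Ω) ^ m, ?_⟩
      rw [add_pow_expChar_pow, pow_add, pow_mul, hx', mul_comm (ringExpChar Ω ^ m), pow_mul,
        hy', ← map_pow, ← map_pow, ← map_add]
    | inv x _ ihx =>
      obtain ⟨n, x', hx'⟩ := ihx
      exact ⟨n, x'⁻¹, by rw [inv_pow, hx', map_inv₀]⟩
    | mul x y _ _ ihx ihy =>
      obtain ⟨m, x', hx'⟩ := ihx
      obtain ⟨n, y', hy'⟩ := ihy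
      refine ⟨m + n, x' ^ (ringExpChar Ω) ^ n * y' ^ (ringExpChar Ω) ^ m, ?_⟩
      rw [mul_pow, pow_add, pow_mul, hx', mul_comm (ringExpChar Ω ^ m), pow_mul, hy',
        ← map_pow, ← map_pow, ← map_mul]
  -- the `F`-embedding `κ ∘ j` attached to an `F'`-embedding `κ` of `L'`
  let ψof : (L' →ₐ[F'] Ω) → (L →ₐ[F] Ω) := fun κ =>
    { toRingHom := κ.toRingHom.comp j
      commutes' := fun c => by
        change κ (j (algebraMap F L c)) = algebraMap F Ω c
        rw [hjF, κ.commutes]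
        exact (IsScalarTower.algebraMap_apply F F' Ω c).symm }
  have hψof : ∀ κ : L' →ₐ[F'] Ω, ∀ x : L, ψof κ x = κ (j x) := fun _ _ => rfl
  have hψcomap : ∀ κ : L' →ₐ[F'] Ω,
      (V.comap κ.toRingHom).comap j = V.comap (ψof κ).toRingHom := fun κ => by
    rw [ValuationSubring.comap_comap]
  -- the sets of extensions
  obtain ⟨s', hs', hsum'⟩ := hSD L' inferInstance inferInstance
  obtain ⟨s, hs, -⟩ := FundamentalInequality_holds F L inferInstance (V.comap (algebraMap F Ω))
  refine ⟨s, hs, ?_⟩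
  -- (1) restriction maps extensions of `V ∩ F'` to `L'` to extensions of `V ∩ F` to `L`
  have hr_mem : ∀ O'' ∈ s', O''.comap j ∈ s := by
    intro O'' hO''
    have h := (hs' O'').mp hO''
    refine (hs _).mpr ?_
    ext c
    rw [ValuationSubring.mem_comap, ValuationSubring.mem_comap, hjF, ← ValuationSubring.mem_comap,
      h]
    rfl
  -- (2) it is injective (`L' | j(L)` is purely inseparable)
  have hq0 : ∀ n : ℕ, ringExpChar Ω ^ n ≠ 0 := fun n => pow_ne_zero n (expChar_ne_zero Ω _)
  have hmem_iff : ∀ (O₁ O₂ : ValuationSubring L'), O₁.comap j = O₂.comap j →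
      ∀ y : L', y ∈ O₁ → y ∈ O₂ := by
    intro O₁ O₂ h12 y hy1
    obtain ⟨n, x, hx⟩ := hpow y y.2
    have hyx : y ^ ringExpChar Ω ^ n = j x := Subtype.ext (by rw [SubmonoidClass.coe_pow]; exact hx)
    have h1 : y ^ ringExpChar Ω ^ n ∈ O₁ := O₁.pow_mem hy1 _
    rw [hyx, ← ValuationSubring.mem_comap, h12, ValuationSubring.mem_comap, ← hyx] at h1
    exact mem_of_pow_mem (hq0 n) h1
  have hr_inj : ∀ O₁ ∈ s', ∀ O₂ ∈ s', O₁.comap j = O₂.comap j → O₁ = O₂ := by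
    intro O₁ _ O₂ _ h12
    ext y
    exact ⟨hmem_iff O₁ O₂ h12 y, hmem_iff O₂ O₁ h12.symm y⟩
  -- (3) it is surjective (every extension to `L` is cut out by an embedding `ι = κ ∘ j`)
  have hadj : Algebra.adjoin F {α} = ⊤ :=
    Algebra.adjoin_eq_top_of_primitive_element hαint.isAlgebraic hα
  have hr_surj : ∀ O' ∈ s, ∃ O'' ∈ s', O''.comap j = O' := by
    intro O' hO'
    obtain ⟨ι, hι⟩ := exists_algHom_comap_eq V F O' ((hs O').mp hO')
    have hroot : ι α ∈ (minpoly F' (ι₀ α)).aroots Ω := by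
      rw [Polynomial.mem_aroots, hmin]
      refine ⟨Polynomial.map_ne_zero (minpoly.ne_zero hαint), ?_⟩
      rw [Polynomial.aeval_map_algebraMap, Polynomial.aeval_algHom_apply, minpoly.aeval, map_zero]
    let κ : L' →ₐ[F'] Ω :=
      (IntermediateField.algHomAdjoinIntegralEquiv F' hbint').symm ⟨ι α, hroot⟩
    have hκgen : κ (IntermediateField.AdjoinSimple.gen F' (ι₀ α)) = ι α :=
      IntermediateField.algHomAdjoinIntegralEquiv_symm_apply_gen F' hbint' ⟨ι α, hroot⟩
    have hκα : ψof κ α = ι α := by rw [hψof, hjα, hκgen]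
    have hψ : ψof κ = ι := by
      apply AlgHom.ext
      intro x
      have hx : x ∈ Algebra.adjoin F {α} := hadj ▸ Algebra.mem_top
      rw [Algebra.adjoin_singleton_eq_range_aeval] at hx
      obtain ⟨p, rfl⟩ := hx
      change ψof κ (Polynomial.aeval α p) = ι (Polynomial.aeval α p)
      rw [← Polynomial.aeval_algHom_apply, ← Polynomial.aeval_algHom_apply, hκα]
    refine ⟨V.comap κ.toRingHom, (hs' _).mpr ?_, ?_⟩
    · ext c
      rw [ValuationSubring.mem_comap, ValuationSubring.mem_comap]
      change κ (algebraMap F' L' c) ∈ V ↔ (c : Ω) ∈ V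
      rw [κ.commutes]
      rfl
    · rw [hψcomap, hψ, hι]
  -- (4) the summands agree: `e(O'' ∩ L | F) f(O'' ∩ L | F) = e(O'' | F') f(O'' | F')`
  have hFF'range : Set.range (algebraMap F Ω) ⊆ Set.range (algebraMap F' Ω) := by
    rintro _ ⟨c, rfl⟩
    exact ⟨⟨c, hFF' c.2⟩, rfl⟩
  have hvF : valueSubgroup F V = valueSubgroup F' V := by
    refine valueSubgroup_eq_of_dense V hFF'range ?_
    rintro _ ⟨c, rfl⟩ hc0
    obtain ⟨z, hzF, hz, -⟩ := hdense.exists_valuation_eq c.2 hc0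
    exact ⟨z, ⟨⟨z, hzF⟩, rfl⟩, hz⟩
  have hrF : residueSubfield F V = residueSubfield F' V := by
    refine residueSubfield_eq_of_dense V hFF'range ?_
    rintro _ ⟨c, rfl⟩ -
    obtain ⟨z, hzF, hz⟩ := hdense (c : Ω) c.2 1 F'.one_mem one_ne_zero
    exact ⟨z, ⟨⟨z, hzF⟩, rfl⟩, by rwa [map_one] at hz⟩
  have hsummand : ∀ O'' ∈ s',
      ramificationIndex F (O''.comap j) * inertiaDegree F (O''.comap j) =
        ramificationIndex F' O'' * inertiaDegree F' O'' := by
    intro O'' hO''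
    obtain ⟨κ, hκ⟩ := exists_algHom_comap_eq V F' O'' ((hs' O'').mp hO'')
    rw [← hκ, hψcomap, ramificationIndex_comap_algHom, inertiaDegree_comap_algHom,
      ramificationIndex_comap_algHom, inertiaDegree_comap_algHom]
    -- `ψ(L) ⊆ κ(L')` is dense
    have hsub : Set.range (algebraMap (ψof κ).fieldRange Ω) ⊆
        Set.range (algebraMap κ.fieldRange Ω) := by
      rw [range_algebraMap_fieldRange, range_algebraMap_fieldRange]
      rintro _ ⟨x, rfl⟩
      exact ⟨j x, rfl⟩
    have hψα0 : ψof κ α ≠ 0 := (map_ne_zero_iff _ (ψof κ).injective).mpr hα0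
    have hvα : 0 < V.valuation (ψof κ α) := (Valuation.pos_iff _).mpr hψα0
    have hdense' : ∀ w ∈ Set.range (algebraMap κ.fieldRange Ω),
        ∀ t ∈ Set.range (algebraMap κ.fieldRange Ω), t ≠ 0 →
        ∃ z ∈ Set.range (algebraMap (ψof κ).fieldRange Ω),
          V.valuation (w - z) < V.valuation t := by
      rw [range_algebraMap_fieldRange, range_algebraMap_fieldRange]
      rintro _ ⟨y, rfl⟩ _ ⟨t, rfl⟩ ht0
      have ht0' : t ≠ 0 := fun h => ht0 (by rw [h, map_zero])
      let pb : PowerBasis F' L' := IntermediateField.adjoin.powerBasis hbint'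
      have hgen : κ pb.gen = ψof κ α := by
        rw [hψof, hjα, IntermediateField.adjoin.powerBasis_gen]
      -- coefficientwise approximation
      have hex : ∀ i : Fin pb.dim, ∃ d ∈ F,
          V.valuation (((pb.basis.repr y i : F') : Ω) - d) * V.valuation (ψof κ α) ^ (i : ℕ) <
            V.valuation (κ t) := by
        intro i
        have hu0 : κ (t / (j α) ^ (i : ℕ)) ≠ 0 :=
          (map_ne_zero_iff _ κ.injective).mpr (div_ne_zero ht0' (pow_ne_zero _ hjα0))
        have hualg : IsAlgebraic F' (κ (t / (j α) ^ (i : ℕ))) :=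
          (Algebra.IsAlgebraic.isAlgebraic (R := F') _).algHom κ
        obtain ⟨c', hc'F', hc'0, hc'le⟩ := exists_valuation_le_of_isAlgebraic V hualg hu0
        obtain ⟨d, hdF, hd⟩ := hdense _ (pb.basis.repr y i).2 c' hc'F' hc'0
        refine ⟨d, hdF, ?_⟩
        have hval : V.valuation (κ (t / (j α) ^ (i : ℕ))) =
            V.valuation (κ t) / V.valuation (ψof κ α) ^ (i : ℕ) := by
          rw [map_div₀, map_pow, map_div₀, Valuation.map_pow, hψof]
        rw [hval, le_div_iff₀ (pow_pos hvα _)] at hc'le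
        exact lt_of_lt_of_le (mul_lt_mul_of_pos_right hd (pow_pos hvα _)) hc'le
      choose d hdF hd using hex
      refine ⟨ψof κ (∑ i, algebraMap F L ⟨d i, hdF i⟩ * α ^ (i : ℕ)), ⟨_, rfl⟩, ?_⟩
      have hy : (y : L') = ∑ i, pb.basis.repr y i • pb.gen ^ (i : ℕ) := by
        conv_lhs => rw [← pb.basis.sum_repr y]
        simp only [PowerBasis.coe_basis]
      have hexp : κ y - ψof κ (∑ i, algebraMap F L ⟨d i, hdF i⟩ * α ^ (i : ℕ)) =
          ∑ i, (((pb.basis.repr y i : F') : Ω) - d i) * (ψof κ α) ^ (i : ℕ) := by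
        conv_lhs => rw [hy, map_sum, map_sum, ← Finset.sum_sub_distrib]
        refine Finset.sum_congr rfl fun i _ => ?_
        rw [map_smul, Algebra.smul_def, map_pow, hgen, map_mul, map_pow, AlgHom.commutes, sub_mul]
        rfl
      rw [hexp]
      refine Valuation.map_sum_lt _ ((Valuation.ne_zero_iff _).mpr ht0) fun i _ => ?_
      rw [Valuation.map_mul, Valuation.map_pow]
      exact hd i
    have hvL : valueSubgroup (ψof κ).fieldRange V = valueSubgroup κ.fieldRange V :=
      valueSubgroup_eq_of_dense V hsub fun w hw hw0 => hdense' w hw w hw hw0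
    have hrL : residueSubfield (ψof κ).fieldRange V = residueSubfield κ.fieldRange V := by
      refine residueSubfield_eq_of_dense V hsub fun w hw _ => ?_
      obtain ⟨z, hz, hlt⟩ := hdense' w hw 1 ⟨1, map_one _⟩ one_ne_zero
      exact ⟨z, hz, by rwa [map_one] at hlt⟩
    rw [hvF, hrF, hvL, hrL]
  -- (5) the sum
  have hs_eq : s = s'.image fun O'' => O''.comap j := by
    ext O'
    rw [Finset.mem_image]
    constructor
    · intro hO'
      obtain ⟨O'', hO'', h⟩ := hr_surj O' hO'
      exact ⟨O'', hO'', h⟩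
    · rintro ⟨O'', hO'', rfl⟩
      exact hr_mem O'' hO''
  rw [hs_eq, Finset.sum_image hr_inj, Finset.sum_congr rfl hsummand, hsum', hdegL', hdegL]

end Descent

end Literature.AlgebraicGeometry.Resolution
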